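import Summits.Ventures.PercRepro.Night2NonFatLevelOne
import Summits.Ventures.PercRepro.Night2NonFatColoopPhi
import Summits.Ventures.PercRepro.Night2NonFatSmall
import Summits.Ventures.PercRepro.Night2LocalDQm1Lossy

/-!
# night-2: the NON-FAT case of (FAIR) — `W` in general position with respect to the active faces (gen 37)

THE GENERAL-POSITION REGIME: no point of `W = G ∖ Q` lies on the hyperplane `cl (Q.erase w)` of an active face `w`.  Then every
active face misses `N + 1` points of `G` (`card_sdiff_clF_erase_of_general`), its request is `7/(6 (N + 3))`, and the pair is
lossy only for `N ≤ 6` (`card_sdiff_le_six_of_loss_ne_zero_general`: `5 · 7/(6 (N + 3)) > 11/18`).  At every level-1 target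
`L1 = 0` (no active hyperplane contains `y`), so `vCap ≥ 11/18`, while `faceSum (Q ∪ {y}) ≤ 2 · 5 · phiM (N + 1) + 20/9` (the five
faces of `Q` at weight `phiM (N + 1)`, at most ten faces through `y` at `2/9`): `N = 5`: `5 · (11/18)/2.458 = 1.24`, `N = 6`:
`6 · (11/18)/2.296 = 1.60`, and `N = 4` is `basis_pair_fair_of_card_sdiff_eq_four`.
**`basis_pair_fair_of_general_position`**.  (With all five faces active this is `S(y) = Q′` for every `y`; the regime is the
opposite end from the nested line — here the faces are small and many, there few and large.)
Paper: proofs/NIGHT-2-g37.md §5.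
-/

namespace PercRepro.Shadow

open PercRepro.ThmH PercRepro.PerFlat

variable {α : Type*} [DecidableEq α] {M : Matroid α} [M.Finite] {G : Finset α}

/-- An active face whose hyperplane contains no point of `W` misses `N + 1` points of `G`: `w` and all of `W`. -/
theorem card_sdiff_clF_erase_of_general (hG : G ∈ flatsQ M (5 + 1)) (hd : (gr M \ G).card = 2)
    (hk : kColoops M G = 1) {B : Finset α} (hB : B ∈ thinMembers M 5 G) (hnP : ¬ bigP M G B) {z : α}
    (hz : z ∈ G \ clF M B) {w : α} (hw : w ∈ insert z B \ coloops M G)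
    (hgen : ∀ y ∈ G \ insert z B, y ∉ clF M ((insert z B).erase w)) :
    (G \ insert z B).card + 1 ≤ (G \ clF M ((insert z B).erase w)).card := by
  have hGg : G ⊆ gr M := (mem_flatsQ.1 hG).1
  have hQG : insert z B ⊆ G := Finset.insert_subset (Finset.mem_sdiff.1 hz).1 (subset_G_of_mem_thinMembers hB)
  have hwQ : w ∈ insert z B := (Finset.mem_sdiff.1 hw).1
  have hwcl : w ∉ clF M ((insert z B).erase w) := notMem_clF_erase_of_mem hG hd hk hB hnP hz hwQ
  have hsub : insert w (G \ insert z B) ⊆ G \ clF M ((insert z B).erase w) := by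
    apply Finset.insert_subset (Finset.mem_sdiff.2 ⟨hQG hwQ, hwcl⟩)
    intro y hy
    exact Finset.mem_sdiff.2 ⟨(Finset.mem_sdiff.1 hy).1, hgen y hy⟩
  have h1 := Finset.card_le_card hsub
  rw [Finset.card_insert_of_notMem (fun h => (Finset.mem_sdiff.1 h).2 hwQ)] at h1
  exact h1

/-- **In general position a lossy basis pair has `N ≤ 6`**: the five requests `7/(6 (N + 3))` must exceed `11/18`. -/
theorem card_sdiff_le_six_of_loss_ne_zero_general (hG : G ∈ flatsQ M (5 + 1)) (hd : (gr M \ G).card = 2)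
    (hk : kColoops M G = 1) {B : Finset α} (hB : B ∈ thinMembers M 5 G) (hnP : ¬ bigP M G B) {z : α}
    (hz : z ∈ G \ clF M B) (hl0 : loss M 5 G B z ≠ 0)
    (hgen : ∀ w ∈ insert z B \ coloops M G, faceOk M G (insert z B) w →
      ∀ y ∈ G \ insert z B, y ∉ clF M ((insert z B).erase w)) :
    (G \ insert z B).card ≤ 6 := by
  have hd' : (gr M \ G).card ≤ 5 := by omega
  have hQG : insert z B ⊆ G := Finset.insert_subset (Finset.mem_sdiff.1 hz).1 (subset_G_of_mem_thinMembers hB)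
  have hcap := capS_ge_eleven_eighteenths_two_one hd hk hQG
  have hlt := capS_lt_L1_of_loss_ne_zero hl0
  rw [L1_eq_sum_req_faces hG hd] at hlt
  set N : ℕ := (G \ insert z B).card with hN
  have hreq : ∀ w ∈ (insert z B \ coloops M G).filter (fun w => faceOk M G (insert z B) w),
      req M 5 ((insert z B).erase w) ≤ phiQ 5 / ((N : ℚ) + 1 + 2) := by
    intro w hw
    rw [Finset.mem_filter] at hw
    rw [req_eq_of_thin hG hw.2.1, hd]
    have hm := card_sdiff_clF_erase_of_general hG hd hk hB hnP hz hw.1 (hgen w hw.1 hw.2)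
    have hm' : (N : ℚ) + 1 ≤ ((G \ clF M ((insert z B).erase w)).card : ℚ) := by exact_mod_cast hm
    push_cast
    apply div_le_div_of_nonneg_left (phiQ_pos 5).le (by positivity)
    linarith
  have hsum : ∑ w ∈ (insert z B \ coloops M G).filter (fun w => faceOk M G (insert z B) w),
      req M 5 ((insert z B).erase w) ≤
      ∑ _w ∈ (insert z B \ coloops M G).filter (fun w => faceOk M G (insert z B) w), phiQ 5 / ((N : ℚ) + 1 + 2) :=
    Finset.sum_le_sum hreq
  rw [Finset.sum_const, nsmul_eq_mul] at hsum
  have hcard5 : ((insert z B \ coloops M G).filter (fun w => faceOk M G (insert z B) w)).card ≤ 5 := by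
    have h4 := card_sdiff_eq_four_of_not_bigP hG hd hk hB hnP
    have hKB : coloops M G ⊆ B := coloops_subset_of_mem_thinMembers hG hd' hB
    have hzB : z ∉ B := fun h => (Finset.mem_sdiff.1 hz).2
      (subset_clF_of_subset_gr ((subset_G_of_mem_thinMembers hB).trans (mem_flatsQ.1 hG).1) h)
    have hQ'card : (insert z B \ coloops M G).card = 5 := by
      rw [insert_sdiff_coloops_eq (fun h => hzB (hKB h)), Finset.card_insert_of_notMem
        (fun h => hzB (Finset.mem_sdiff.1 h).1), h4]
    rw [← hQ'card]
    exact Finset.card_le_card (Finset.filter_subset _ _)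
  have hcard5' : (((insert z B \ coloops M G).filter (fun w => faceOk M G (insert z B) w)).card : ℚ) ≤ 5 := by
    exact_mod_cast hcard5
  have hN3 : (0 : ℚ) < (N : ℚ) + 1 + 2 := by positivity
  have hpos : (0 : ℚ) < phiQ 5 / ((N : ℚ) + 1 + 2) := div_pos (phiQ_pos 5) hN3
  have h1 : (11 / 18 : ℚ) < 5 * (phiQ 5 / ((N : ℚ) + 1 + 2)) := by
    calc (11 / 18 : ℚ) ≤ capS M 5 G (insert z B) := hcap
      _ < _ := hlt
      _ ≤ (((insert z B \ coloops M G).filter (fun w => faceOk M G (insert z B) w)).card : ℚ) *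
          (phiQ 5 / ((N : ℚ) + 1 + 2)) := hsum
      _ ≤ 5 * (phiQ 5 / ((N : ℚ) + 1 + 2)) := mul_le_mul_of_nonneg_right hcard5' hpos.le
  have hp : phiQ 5 = 7 / 6 := by
    unfold phiQ
    norm_num
  have h2 : 11 / 18 * ((N : ℚ) + 1 + 2) < 5 * phiQ 5 := by
    have := mul_lt_mul_of_pos_right h1 hN3
    rw [mul_assoc, div_mul_cancel₀ _ hN3.ne'] at this
    exact this
  rw [hp] at h2
  by_contra h7
  rw [not_le] at h7
  have h7' : (7 : ℚ) ≤ (N : ℚ) := by exact_mod_cast h7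
  linarith

/-- **The face sum at a level-1 target in general position**: the faces of `Q` at weight `2 · phiM (N + 1)` (at most five)
plus at most ten faces through `y` at `2/9`. -/
theorem faceSum_insert_le_general (hG : G ∈ flatsQ M (5 + 1)) (hd : (gr M \ G).card = 2) (hk : kColoops M G = 1)
    (hnf : fatClosures M 5 G 2 = ∅) {B : Finset α} (hB : B ∈ thinMembers M 5 G) (hnP : ¬ bigP M G B) {z : α}
    (hz : z ∈ G \ clF M B) {y : α} (hy : y ∈ G \ insert z B)
    (hgen : ∀ w ∈ insert z B \ coloops M G, faceOk M G (insert z B) w →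
      ∀ y ∈ G \ insert z B, y ∉ clF M ((insert z B).erase w)) :
    faceSum M G (insert y (insert z B)) ≤ 5 * (2 * phiM ((G \ insert z B).card + 1)) + 2 / 9 * 10 := by
  refine le_trans (faceSum_insert_le hG hd hk hnf hB hnP hz hy) ?_
  have hd' : (gr M \ G).card ≤ 5 := by omega
  apply add_le_add
  · -- the faces of `Q`
    have hterm : ∀ w ∈ (insert z B \ coloops M G).filter (fun w => faceOk M G (insert z B) w),
        phiFace M ((insert z B).erase w) *
          (((insert y (insert z B) \ coloops M G) \ clF M ((insert z B).erase w)).card : ℚ) ≤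
        2 * phiM ((G \ insert z B).card + 1) := by
      intro w hw
      rw [Finset.mem_filter] at hw
      have hphi := phiFace_le_of_le hG hd hw.2.1 (card_sdiff_clF_erase_of_general hG hd hk hB hnP hz hw.1 (hgen w hw.1 hw.2))
      have hc := card_sdiff_clF_erase_le_two hG hB hz y (Finset.mem_sdiff.1 hw.1).1
      have hc' : (((insert y (insert z B) \ coloops M G) \ clF M ((insert z B).erase w)).card : ℚ) ≤ 2 := by
        have : ((insert y (insert z B) \ coloops M G) \ clF M ((insert z B).erase w)).card ≤ 2 := by
          refine le_trans hc ?_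
          split_ifs <;> norm_num
        exact_mod_cast this
      calc phiFace M ((insert z B).erase w) *
            (((insert y (insert z B) \ coloops M G) \ clF M ((insert z B).erase w)).card : ℚ)
          ≤ phiM ((G \ insert z B).card + 1) * 2 := mul_le_mul hphi hc' (by positivity) (phiM_nonneg _)
        _ = 2 * phiM ((G \ insert z B).card + 1) := by ring
    have hcard5 : ((insert z B \ coloops M G).filter (fun w => faceOk M G (insert z B) w)).card ≤ 5 := by
      have h4 := card_sdiff_eq_four_of_not_bigP hG hd hk hB hnP
      have hKB : coloops M G ⊆ B := coloops_subset_of_mem_thinMembers hG hd' hB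
      have hzB : z ∉ B := fun h => (Finset.mem_sdiff.1 hz).2
        (subset_clF_of_subset_gr ((subset_G_of_mem_thinMembers hB).trans (mem_flatsQ.1 hG).1) h)
      have hQ'card : (insert z B \ coloops M G).card = 5 := by
        rw [insert_sdiff_coloops_eq (fun h => hzB (hKB h)), Finset.card_insert_of_notMem
          (fun h => hzB (Finset.mem_sdiff.1 h).1), h4]
      rw [← hQ'card]
      exact Finset.card_le_card (Finset.filter_subset _ _)
    calc ∑ w ∈ (insert z B \ coloops M G).filter (fun w => faceOk M G (insert z B) w),
          phiFace M ((insert z B).erase w) *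
            (((insert y (insert z B) \ coloops M G) \ clF M ((insert z B).erase w)).card : ℚ)
        ≤ ∑ _w ∈ (insert z B \ coloops M G).filter (fun w => faceOk M G (insert z B) w),
            2 * phiM ((G \ insert z B).card + 1) := Finset.sum_le_sum hterm
      _ = (((insert z B \ coloops M G).filter (fun w => faceOk M G (insert z B) w)).card : ℚ) *
            (2 * phiM ((G \ insert z B).card + 1)) := by rw [Finset.sum_const, nsmul_eq_mul]
      _ ≤ 5 * (2 * phiM ((G \ insert z B).card + 1)) := by
          apply mul_le_mul_of_nonneg_right _ (mul_nonneg (by norm_num) (phiM_nonneg _))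
          exact_mod_cast hcard5
  · -- the faces through `y`
    apply mul_le_mul_of_nonneg_left _ (by norm_num)
    exact_mod_cast card_facesIn_mem_le_ten hG hd hk hB hnP hz hy

/-- **The general-position regime**: no point of `W` on the hyperplane of an active face ⇒ the fair share. -/
theorem basis_pair_fair_of_general_position (hG : G ∈ flatsQ M (5 + 1)) (hd : (gr M \ G).card = 2)
    (hk : kColoops M G = 1) (hs : ∀ e ∈ gr M, ∀ f ∈ gr M, e ≠ f → rkN M {e, f} = 2)
    (hl : ∀ e ∈ gr M, M.Indep {e}) (hnf : fatClosures M 5 G 2 = ∅) {B : Finset α}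
    (hB : B ∈ thinMembers M 5 G) (hnP : ¬ bigP M G B) {z : α} (hz : z ∈ G \ clF M B)
    (hl0 : loss M 5 G B z ≠ 0)
    (hgen : ∀ w ∈ insert z B \ coloops M G, faceOk M G (insert z B) w →
      ∀ y ∈ G \ insert z B, y ∉ clF M ((insert z B).erase w)) :
    loss M 5 G B z ≤ rhoL M 5 G B z * lossIncomeH M 5 G (bigP M G) (dshGT2 M 5 G) B z := by
  have hfat : (fatClosures M 5 G 2).card ≤ 1 := by
    rw [hnf, Finset.card_empty]
    exact zero_le_one
  have hN4 := four_le_card_sdiff_insert hG hd hB hz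
  have hN6 := card_sdiff_le_six_of_loss_ne_zero_general hG hd hk hB hnP hz hl0 hgen
  -- `N = 4` is the small case
  rcases Nat.lt_or_ge (G \ insert z B).card 5 with h4 | h5
  · exact basis_pair_fair_of_card_sdiff_eq_four hG hd hk hs hl hnf hB hnP hz hl0 (by omega)
  apply basis_pair_fair_of_level_one_sum hG hd hk hs hl hfat hB hnP hz hl0
  -- every level-1 term is at least `(11/18) / (10 · phiM (N + 1) + 20/9)`
  have hterm : ∀ y ∈ G \ insert z B,
      (11 / 18 : ℚ) / (5 * (2 * phiM ((G \ insert z B).card + 1)) + 2 / 9 * 10) ≤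
        vCap M G (insert y (insert z B)) / faceSum M G (insert y (insert z B)) := by
    intro y hy
    have hv := vCap_insert_ge hG hd hk hs hl hB hnP hz hy
    have hfilt : (insert z B \ coloops M G).filter
        (fun w => faceOk M G (insert z B) w ∧ y ∈ clF M ((insert z B).erase w)) = ∅ := by
      rw [Finset.filter_eq_empty_iff]
      intro w hw ⟨hok, hcl⟩
      exact hgen w hw hok y hy hcl
    rw [hfilt, Finset.sum_empty, sub_zero] at hv
    have hpos := faceSum_pos_of_mem_tgtSets hG hd hk hB hnP hz hl0
      (level_one_targets_subset hG hB hz (Finset.mem_image.2 ⟨y, hy, rfl⟩))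
    have hle := faceSum_insert_le_general hG hd hk hnf hB hnP hz hy hgen
    have hden : (0 : ℚ) < 5 * (2 * phiM ((G \ insert z B).card + 1)) + 2 / 9 * 10 := by
      have := phiM_nonneg ((G \ insert z B).card + 1)
      linarith
    rw [div_le_div_iff₀ hden hpos]
    nlinarith [vCap_nonneg (M := M) (G := G) (insert y (insert z B)), phiM_nonneg ((G \ insert z B).card + 1)]
  have hbound : (1 : ℚ) ≤ ((G \ insert z B).card : ℚ) *
      ((11 / 18 : ℚ) / (5 * (2 * phiM ((G \ insert z B).card + 1)) + 2 / 9 * 10)) := by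
    -- `N ∈ {5, 6}`: `phiM 6 = 17/720`, `phiM 7 = 1/135`
    have hN' : (G \ insert z B).card = 5 ∨ (G \ insert z B).card = 6 := by omega
    rcases hN' with h | h <;> rw [h]
    · have : phiM (5 + 1) = 17 / 720 := by
        unfold phiM phiQ
        norm_num
      rw [this]
      norm_num
    · have : phiM (6 + 1) = 1 / 135 := by
        unfold phiM phiQ
        norm_num
      rw [this]
      norm_num
  calc (1 : ℚ) ≤ ((G \ insert z B).card : ℚ) *
        ((11 / 18 : ℚ) / (5 * (2 * phiM ((G \ insert z B).card + 1)) + 2 / 9 * 10)) := hbound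
    _ = ∑ _y ∈ G \ insert z B, (11 / 18 : ℚ) / (5 * (2 * phiM ((G \ insert z B).card + 1)) + 2 / 9 * 10) := by
        rw [Finset.sum_const, nsmul_eq_mul]
    _ ≤ ∑ y ∈ G \ insert z B, vCap M G (insert y (insert z B)) / faceSum M G (insert y (insert z B)) :=
        Finset.sum_le_sum hterm

end PercRepro.Shadow
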